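import Summits.PneNP.PneNP.Theorems.ChebyshevTracialDesignGammaDirectionNullTerms
import Summits.PneNP.PneNP.Theorems.ChebyshevTracialDesignGammaDirectionMainTerm
import HarnessLib

/-!
# Cell pnp-psdrank, route `ChebyshevTracialDesign`: THE γ-DIRECTION PINNING REDUCTION — per matching, the tilted (CG_1′) value of a block
# statistic in ANY type-constant direction is minus the virtual value of the GENUINE tilted profile, up to pure remainders
# (crux `TracialDecayExp20`, stmt-PneNP-19878)

Brick 129 (prover g26; MEMO-25 §2(d), MEMO-28 §3/§3c line (L-b), MEMO-29). The (CG_1′) containment form of a mask `f(U) = ψ(|U∩H|)` at a matching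
`M` in direction `u` is `Σ_U W(U,M)·ψ(|U∩H|)·C_u(U)²`, `C_u(U) = Σ_p u_p x_p x_{π_M p}` (bricks 101–106). A TYPE-CONSTANT direction assigns
`S_A, S_B, S_D` to the vertices on `HH`, mixed, `H̄H̄` edges; with `u_p = γ[p∈H][πp∈H] + λ([p∈H][πp∈H] − [p∉H][πp∉H]) + (λ+κ)` (every type-constant
direction; `γ = S_A − 2S_B + S_D = 0` is brick 120's crossing plane) Literature `gammaWeight_containment_eq` gives ON EVERY CUT
`C_u = 2γ·n_A + 2λ(X − Y) + κ(t − c)`, `n_A` = number of `HH` edges of `M` inside `U`, `X = |U∩H|`, `Y = |half_M U ∩ H|`, `c = cc(U,M)`. Hence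
`ψ·C_u² = ψ·(2λ(X−Y) + κ(t−c))² + [4γ²ψ·n_A(n_A−1) + χ(X)·n_A] − 8γλ·ψ·n_A·Y − 4γκ·c·ψ·n_A`, `χ = 4γ²ψ + 4γψ·(2λX+κt)`:
brick 120 (the crossing-plane part, verbatim, as a black box), brick 129c (the `n_A`-moments: design value = minus virtual value ± remainder, the
GENUINE level-`c` pinning probabilities kept), bricks 129b (the two terms with a factor `c`: virtually null). Summing:

* **`abs_gammaDirection_value_add_newton_le`** (THE THEOREM): for every exact design with `2(D+1)+4 ≤ t`, `T + 4 ≤ t`, `2D+1 ≤ T`, every matching `M`,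
  block `H`, `|ψ| ≤ G` on `[0,t]`, `|γ|,|λ|,|κ| ≤ 1`, `m ≥ 3`, `m + 4(D+1) + 4 ≤ n`, and ONE family of `x`-smoothness numbers `X_k ≥ 0` (`k ≤ D+1`, levels
  `c′ + 2k ≤ T`, ground sets `[n]` minus `r ≤ 2` pinned edges and `2k` deleted edges, cut `t − s − 2k` with `r ≤ s ≤ 2r` pinned vertices — brick 120's
  family is the sub-family `s = r`):
  `| |PM|·Σ_U W(U,M)·ψ(|U∩H|)·(Σ_p u_p x_p x_{πp})² + N^{odd}_D[Φ](0) | ≤ R₁₂₀ + R₇ + 12·R′`,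
  **`Φ(c) = E_{Shell_c(M)}[ψ(X)·(2γ·n_A + 2λX + κt)²]`** — the GENUINE level-`c` joint law of `(X, n_A)`, so `Φ` and each of its `x`-sections
  `Q_c(x) = E_c[1_{X=x}ψ(x)(2γ n_A + 2λx + κt)²]` is `≥ 0` at every genuine level for `ψ ≥ 0` (what brick 121's one-sided criterion needs; MEMO-28 §3c:
  in the CENTRED basis `n_A − E_1[n_A|X=x]` the `2×2` form is diagonal at level `1` and the criterion passes numerically, kit j318467);
  `R₁₂₀` = brick 120's seven remainders, `R₇` = brick 129c's with `G₂ = 16tG`, `|α| ≤ 4`, `R′` = bricks 129b's common bound (coefficients `8|γλ| + 4|γκ| ≤ 12`).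
READING: per matching, (CG_1′) for `H`-symmetric masks in EVERY type-constant direction is — up to pure remainders of orders `D−1, D, D+1` — the sign of
ONE virtual value `N^{odd}_D[Φ](0)`; the crossing plane (`γ = 0`, bricks 120–128) is the case where `Φ` involves the law of `X` alone. (O3) of MEMO-25 §4 is
thereby reduced to the [BULK] relative level-smoothness of the centred second-moment profile (MEMO-28 §3c (ii)–(iii); lit's `TrinomialLineSection`).
WHAT THIS FILE DOES NOT DO: sign `N^{odd}_D[Φ](0)` (next bricks), discharge the `X_k` by the `H`-type (brick 125's argument on the larger family),
directions that are not type-constant (general `|v_e| ≤ 1`: diagonal-excess sign, MEMO-25 §4), anything on `TracialDecayExp20` itself, psd rank of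
P_PM(K_n), or P vs NP.
[cite: Rothvoss2017, §2 (PDF p. 6)] [cite: Agarwal2000DifferenceEquations, Thm. 1.8.5 (1.8.6), Remark 1.8.1 (1.8.8)]
[cite: GriblingDelaatLaurent2019, §5]
Stature: support/instrument (kernel lane, no defs, axioms standard). Supports stmt-PneNP-19878.
-/

set_option linter.dupNamespace false -- `Summit.PneNP.PneNP.…`: summit = sub-problem (D-0017)

noncomputable section

namespace Summit.PneNP.PneNP.Theorems.ChebyshevTracialDesignGammaDirectionReduction

open Finset Polynomial Literature.Barriers.PneNP Literature.Combinatorics.Optimization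
open Literature.Combinatorics.Optimization.ShellStep
open Summit.PneNP.PneNP.Theorems.ChebyshevTracialDesignShellOperatorForm (designValue_eq_shellAvg)
open Summit.PneNP.PneNP.Theorems.ChebyshevTracialDesignBlockStatisticPricing (rho_nonneg)
open Summit.PneNP.PneNP.Theorems.ChebyshevTracialDesignCrossingPlaneTools (levelWeight_eq_zero_of_card_ne)
open Summit.PneNP.PneNP.Theorems.ChebyshevTracialDesignCrossingPlaneReduction (abs_crossingPlane_value_add_newton_le)
open Summit.PneNP.PneNP.Theorems.ChebyshevTracialDesignGammaDirectionTools (newtonPolyOdd_eval_zero_add)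
open Summit.PneNP.PneNP.Theorems.ChebyshevTracialDesignGammaDirectionNullTerms (abs_designValue_level_hhCount_blockStat_le
  abs_designValue_hhCount_halfCount_blockStat_le)
open Summit.PneNP.PneNP.Theorems.ChebyshevTracialDesignGammaDirectionMainTerm (abs_levelSum_hhMoments_add_newton_le)

variable {n : ℕ}

/-! ### The combination step -/

/-- Triangle inequality for the four-term split `P·(a₀ + a₇ + c₉a₉ + c₈a₈) + (N₀ + N₇)` with `|c₉| ≤ 8`, `|c₈| ≤ 4` and a common bound for the last two terms.
[folklore] -/
theorem abs_combine_le {P a0 a7 a8 a9 A7 N0 N7 c8 c9 b0 b7 b7' b' : ℝ}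
    (h0 : |P * a0 + N0| ≤ b0) (he7 : P * a7 = A7) (h7 : |A7 + N7| ≤ b7) (hb7 : b7 ≤ b7')
    (h9 : |P * a9| ≤ b') (h8 : |P * a8| ≤ b') (hc9 : |c9| ≤ 8) (hc8 : |c8| ≤ 4) :
    |P * (a0 + a7 + c9 * a9 + c8 * a8) + (N0 + N7)| ≤ b0 + b7' + 12 * b' := by
  have e : P * (a0 + a7 + c9 * a9 + c8 * a8) + (N0 + N7) =
      (P * a0 + N0) + (A7 + N7) + c9 * (P * a9) + c8 * (P * a8) := by rw [← he7]; ring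
  rw [e]
  have h1 := abs_add_le ((P * a0 + N0) + (A7 + N7) + c9 * (P * a9)) (c8 * (P * a8))
  have h2 := abs_add_le ((P * a0 + N0) + (A7 + N7)) (c9 * (P * a9))
  have h3 := abs_add_le (P * a0 + N0) (A7 + N7)
  rw [abs_mul] at h1 h2
  have h4 := mul_le_mul hc9 h9 (abs_nonneg _) (by norm_num : (0 : ℝ) ≤ 8)
  have h5 := mul_le_mul hc8 h8 (abs_nonneg _) (by norm_num : (0 : ℝ) ≤ 4)
  linarith

/-! ### The γ-direction reduction -/

/-- **THE γ-DIRECTION PINNING REDUCTION (brick 129).** For an exact design `(n,t,T,D,B_v,C,w)` with `2(D+1)+4 ≤ t` and `T+4 ≤ t`, a perfect matching `M`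
(partner map `π`), a block `H`, a profile `|ψ| ≤ G` on `[0,t]`, type-constant direction parameters `|γ|, |λ|, |κ| ≤ 1`
(`u_p = γ[p∈H][πp∈H] + λ([p∈H][πp∈H] − [p∉H][πp∉H]) + (λ+κ)`), `m ≥ 3`, `m + 4(D+1) + 4 ≤ n`, `2D+1 ≤ T`, and ONE family of `x`-smoothness numbers
`X_k ≥ 0` (`k ≤ D+1`; `r ≤ 2`, `r ≤ s ≤ 2r`; every level `c′` with `c′ + 2k ≤ T`; every `π`-stable `S′` with `|S′| + 4k + 2r = n`; cut `t − s − 2k`, window `[0, t−s]`):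
`| |PM|·Σ_U W(U,M)·ψ(|U∩H|)·(Σ_p u_p x_p x_{πp})² + N^{odd}_D[Φ](0) | ≤ R₁₂₀ + R₇ + 12R′`, where
`Φ(c) = E_{Shell_c(M)}[ψ(|U∩H|)·(2γ·n_A(U) + 2λ|U∩H| + κt)²]` is the GENUINE tilted profile (`n_A(U) = #{v ∈ reps(vAA) : v, πv ∈ U}`), `R₁₂₀` is brick 120's
remainder (seven terms), `R₇ = B_v·C((T−1)/2,D+1)·(16tG(tρ^{D+1}X_{D+1} + 2(D+1)ρ^DX_D) + 4G(t(tρ^{D+1}X_{D+1} + 2(D+1)ρ^DX_D) + 2(D+1)(tρ^DX_D + 2Dρ^{D−1}X_{D−1})))`,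
`R′ = c_D K_D + B_v·C((T−1)/2,D+1)·(T K_{D+1} + 2(D+1) K_D)`, `K_k = tGρ^kX_k + 2kGρ^{k−1}X_{k−1}`, `ρ = m/(4(m−2))`, `c_D = (2D+1)C(2D,D)/4^D` — all pure
remainders of orders `D−1, D, D+1`.
[cite: Rothvoss2017, §2 (PDF p. 6)] [cite: Agarwal2000DifferenceEquations, Thm. 1.8.5 (1.8.6), Remark 1.8.1 (1.8.8)]
[cite: GriblingDelaatLaurent2019, §5] -/
theorem abs_gammaDirection_value_add_newton_le {t T D : ℕ} {Bv : ℝ} {C : Finset ℕ} {w : ℕ → ℝ}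
    (hdes : IsExactDesign n t T D Bv C w) (hDT : 2 * D + 1 ≤ T) (hT4 : T + 4 ≤ t) (h4t : 2 * (D + 1) + 4 ≤ t)
    (M : PMatch n) (H : Finset (Fin n)) (ψ : ℤ → ℝ) {G : ℝ} (hG0 : 0 ≤ G)
    (hG : ∀ x ∈ Icc (0 : ℤ) (t : ℤ), |ψ x| ≤ G)
    (gam lam kap : ℝ) (hgam : |gam| ≤ 1) (hlam : |lam| ≤ 1) (hkap : |kap| ≤ 1)
    {m : ℕ} (hm : 3 ≤ m) (hmn : m + 4 * (D + 1) + 4 ≤ n) (X : ℕ → ℝ) (hX0 : ∀ k, 0 ≤ X k)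
    (hX : ∀ k, k ≤ D + 1 → ∀ r s : ℕ, r ≤ 2 → r ≤ s → s ≤ 2 * r → ∀ c' : ℕ, c' + 2 * k ≤ T →
      ∀ S' : Finset (Fin n), (∀ u ∈ S', M.2.partner u ∈ S') → S'.card + 4 * k + 2 * r = n →
      ∑ x ∈ Icc (0 : ℤ) ((t - s : ℕ) : ℤ),
        |nab2^[k] (fun c x => shellLaw M.2.partner S' H (t - s - 2 * k) c x : Profile) c' x| ≤ X k) :
    |(Fintype.card (PMatch n) : ℝ) * ∑ U : OddSet n, levelWeight n t C w U M *
        (ψ ((U.1 ∩ H).card : ℤ) *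
          (∑ p : Fin n, (gam * (if (p ∈ H ∧ M.2.partner p ∈ H) then (1 : ℝ) else 0) +
              (lam * ((if (p ∈ H ∧ M.2.partner p ∈ H) then (1 : ℝ) else 0) -
                (if (p ∉ H ∧ M.2.partner p ∉ H) then (1 : ℝ) else 0)) + (lam + kap))) *
            ((if p ∈ U.1 then (1 : ℝ) else 0) * (if M.2.partner p ∈ U.1 then (1 : ℝ) else 0))) ^ 2) +
      (DesignRemainder.newtonPolyOdd D (fun c =>
        (∑ U' ∈ shell M.2.partner t c,
          ψ ((U' ∩ H).card : ℤ) *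
            (2 * gam * ((((reps M.2.partner (vAA M.2.partner univ H)).filter fun v => v ∈ U' ∧ M.2.partner v ∈ U').card : ℕ) : ℝ) +
              2 * lam * ((U' ∩ H).card : ℤ) + kap * (t : ℝ)) ^ 2) /
          ((shell M.2.partner t c).card : ℝ))).eval 0| ≤
      -- R₁₂₀ (brick 120)
      (-- R₀
      Bv * ((((T - 1) / 2).choose (D + 1) : ℕ) : ℝ) *
          ((9 * (t : ℝ) ^ 2 * G) * (((m : ℝ) / (4 * ((m : ℝ) - 2))) ^ (D + 1) * X (D + 1))) +
      -- 2 R₁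
      2 * ((2 * (D : ℝ) + 1) * ((((2 * D).choose D : ℕ) : ℝ) / (4 : ℝ) ^ D) *
            ((3 * (t : ℝ) * G) * (((m : ℝ) / (4 * ((m : ℝ) - 2))) ^ D * X D)) +
          Bv * ((((T - 1) / 2).choose (D + 1) : ℕ) : ℝ) *
            ((T : ℝ) * ((3 * (t : ℝ) * G) * (((m : ℝ) / (4 * ((m : ℝ) - 2))) ^ (D + 1) * X (D + 1))) +
              2 * ((D : ℝ) + 1) * ((3 * (t : ℝ) * G) * (((m : ℝ) / (4 * ((m : ℝ) - 2))) ^ D * X D)))) +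
      -- R₂
      ((2 * (D : ℝ) + 1) * ((((2 * D).choose D : ℕ) : ℝ) / (4 : ℝ) ^ D) *
          ((T : ℝ) * (G * (((m : ℝ) / (4 * ((m : ℝ) - 2))) ^ D * X D)) +
            2 * (D : ℝ) * (G * (((m : ℝ) / (4 * ((m : ℝ) - 2))) ^ (D - 1) * X (D - 1)))) +
        Bv * ((((T - 1) / 2).choose (D + 1) : ℕ) : ℝ) *
          ((T : ℝ) * ((T : ℝ) * (G * (((m : ℝ) / (4 * ((m : ℝ) - 2))) ^ (D + 1) * X (D + 1))) +
              2 * ((D : ℝ) + 1) * (G * (((m : ℝ) / (4 * ((m : ℝ) - 2))) ^ D * X D))) +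
            2 * ((D : ℝ) + 1) * ((T : ℝ) * (G * (((m : ℝ) / (4 * ((m : ℝ) - 2))) ^ D * X D)) +
              2 * (D : ℝ) * (G * (((m : ℝ) / (4 * ((m : ℝ) - 2))) ^ (D - 1) * X (D - 1)))))) +
      -- 4 R₃
      4 * ((2 * (D : ℝ) + 1) * ((((2 * D).choose D : ℕ) : ℝ) / (4 : ℝ) ^ D) *
            (((H.card : ℝ) / n) * ((3 * (t : ℝ) * G) * (((m : ℝ) / (4 * ((m : ℝ) - 2))) ^ D * X D))) +
          Bv * ((((T - 1) / 2).choose (D + 1) : ℕ) : ℝ) *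
            ((T : ℝ) * (((H.card : ℝ) / n) * ((3 * (t : ℝ) * G) *
                (((m : ℝ) / (4 * ((m : ℝ) - 2))) ^ (D + 1) * X (D + 1)))) +
              2 * ((D : ℝ) + 1) * (((H.card : ℝ) / n) * ((3 * (t : ℝ) * G) *
                (((m : ℝ) / (4 * ((m : ℝ) - 2))) ^ D * X D))))) +
      -- 4 R₄
      4 * ((2 * (D : ℝ) + 1) * ((((2 * D).choose D : ℕ) : ℝ) / (4 : ℝ) ^ D) *
            ((T : ℝ) * (((H.card : ℝ) / n) * (G * (((m : ℝ) / (4 * ((m : ℝ) - 2))) ^ D * X D))) +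
              2 * (D : ℝ) * (((H.card : ℝ) / n) * (G * (((m : ℝ) / (4 * ((m : ℝ) - 2))) ^ (D - 1) * X (D - 1))))) +
          Bv * ((((T - 1) / 2).choose (D + 1) : ℕ) : ℝ) *
            ((T : ℝ) * ((T : ℝ) * (((H.card : ℝ) / n) * (G * (((m : ℝ) / (4 * ((m : ℝ) - 2))) ^ (D + 1) * X (D + 1)))) +
                2 * ((D : ℝ) + 1) * (((H.card : ℝ) / n) * (G * (((m : ℝ) / (4 * ((m : ℝ) - 2))) ^ D * X D)))) +
              2 * ((D : ℝ) + 1) * ((T : ℝ) * (((H.card : ℝ) / n) * (G * (((m : ℝ) / (4 * ((m : ℝ) - 2))) ^ D * X D))) +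
                2 * (D : ℝ) * (((H.card : ℝ) / n) * (G * (((m : ℝ) / (4 * ((m : ℝ) - 2))) ^ (D - 1) * X (D - 1))))))) +
      -- 4 R₅
      4 * ((2 * (D : ℝ) + 1) * ((((2 * D).choose D : ℕ) : ℝ) / (4 : ℝ) ^ D) *
            (((H.card : ℝ) / n) * (G * (((m : ℝ) / (4 * ((m : ℝ) - 2))) ^ D * X D))) +
          Bv * ((((T - 1) / 2).choose (D + 1) : ℕ) : ℝ) *
            ((T : ℝ) * (((H.card : ℝ) / n) * (G * (((m : ℝ) / (4 * ((m : ℝ) - 2))) ^ (D + 1) * X (D + 1)))) +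
              2 * ((D : ℝ) + 1) * (((H.card : ℝ) / n) * (G * (((m : ℝ) / (4 * ((m : ℝ) - 2))) ^ D * X D))))) +
      -- 4 R₆
      4 * ((2 * (D : ℝ) + 1) * ((((2 * D).choose D : ℕ) : ℝ) / (4 : ℝ) ^ D) *
            (((H.card : ℝ) ^ 2 / ((n : ℝ) * ((n : ℝ) - 2))) * (G * ((T : ℝ) * (((m : ℝ) / (4 * ((m : ℝ) - 2))) ^ D * X D) +
              2 * (D : ℝ) * (((m : ℝ) / (4 * ((m : ℝ) - 2))) ^ (D - 1) * X (D - 1))))) +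
          Bv * ((((T - 1) / 2).choose (D + 1) : ℕ) : ℝ) *
            ((T : ℝ) * (((H.card : ℝ) ^ 2 / ((n : ℝ) * ((n : ℝ) - 2))) *
                (G * ((T : ℝ) * (((m : ℝ) / (4 * ((m : ℝ) - 2))) ^ (D + 1) * X (D + 1)) +
                  2 * ((D : ℝ) + 1) * (((m : ℝ) / (4 * ((m : ℝ) - 2))) ^ D * X D)))) +
              2 * ((D : ℝ) + 1) * (((H.card : ℝ) ^ 2 / ((n : ℝ) * ((n : ℝ) - 2))) *
                (G * ((T : ℝ) * (((m : ℝ) / (4 * ((m : ℝ) - 2))) ^ D * X D) +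
                  2 * (D : ℝ) * (((m : ℝ) / (4 * ((m : ℝ) - 2))) ^ (D - 1) * X (D - 1)))))))) +
      -- R₇ (brick 129c with G₂ = 16tG, |α| ≤ 4)
      Bv * ((((T - 1) / 2).choose (D + 1) : ℕ) : ℝ) *
        (16 * (t : ℝ) * G * ((t : ℝ) * (((m : ℝ) / (4 * ((m : ℝ) - 2))) ^ (D + 1) * X (D + 1)) + 2 * ((D : ℝ) + 1) * (((m : ℝ) / (4 * ((m : ℝ) - 2))) ^ D * X D)) +
          4 * (G * ((t : ℝ) * ((t : ℝ) * (((m : ℝ) / (4 * ((m : ℝ) - 2))) ^ (D + 1) * X (D + 1)) + 2 * ((D : ℝ) + 1) * (((m : ℝ) / (4 * ((m : ℝ) - 2))) ^ D * X D)) +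
            2 * ((D : ℝ) + 1) * ((t : ℝ) * (((m : ℝ) / (4 * ((m : ℝ) - 2))) ^ D * X D) + 2 * (D : ℝ) * (((m : ℝ) / (4 * ((m : ℝ) - 2))) ^ (D - 1) * X (D - 1)))))) +
      -- 12 R′ (bricks 129b)
      12 * ((2 * (D : ℝ) + 1) * ((((2 * D).choose D : ℕ) : ℝ) / (4 : ℝ) ^ D) *
          ((t : ℝ) * (G * (((m : ℝ) / (4 * ((m : ℝ) - 2))) ^ D * X D)) +
            2 * (D : ℝ) * (G * (((m : ℝ) / (4 * ((m : ℝ) - 2))) ^ (D - 1) * X (D - 1)))) +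
        Bv * ((((T - 1) / 2).choose (D + 1) : ℕ) : ℝ) *
          ((T : ℝ) * ((t : ℝ) * (G * (((m : ℝ) / (4 * ((m : ℝ) - 2))) ^ (D + 1) * X (D + 1))) +
              2 * ((D : ℝ) + 1) * (G * (((m : ℝ) / (4 * ((m : ℝ) - 2))) ^ D * X D))) +
            2 * ((D : ℝ) + 1) * ((t : ℝ) * (G * (((m : ℝ) / (4 * ((m : ℝ) - 2))) ^ D * X D)) +
              2 * (D : ℝ) * (G * (((m : ℝ) / (4 * ((m : ℝ) - 2))) ^ (D - 1) * X (D - 1)))))) := by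
  obtain ⟨t₁, rfl⟩ : ∃ t₁, t = t₁ + 2 * (D + 1) + 2 := ⟨t - 2 * (D + 1) - 2, by omega⟩
  have hπ : ∀ v, M.2.partner (M.2.partner v) = v := partner_partner M
  have hπ' : ∀ v, M.2.partner v ≠ v := partner_ne M
  have ht : Odd (t₁ + 2 * (D + 1) + 2) := hdes.1
  have hPM : (0 : ℝ) < (Fintype.card (PMatch n) : ℝ) := by
    have : 0 < Fintype.card (PMatch n) := Fintype.card_pos_iff.2 ⟨M⟩
    exact_mod_cast this
  have hBv : 0 ≤ Bv := le_trans (sum_nonneg fun c _ => abs_nonneg _) hdes.variation_le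
  have hρ0 : (0 : ℝ) ≤ ((m : ℝ) / (4 * ((m : ℝ) - 2))) := rho_nonneg hm
  have ht1 : (1 : ℝ) ≤ ((t₁ + 2 * (D + 1) + 2 : ℕ) : ℝ) := by exact_mod_cast (show 1 ≤ (t₁ + 2 * (D + 1) + 2) by omega)
  -- the auxiliary profile `χ = 4γ²ψ + 4γψ·(2λx + κt)`
  obtain ⟨χ, hχ⟩ : ∃ χ : ℤ → ℝ, χ = fun x => 4 * gam ^ 2 * ψ x + 4 * gam * (ψ x * (2 * lam * (x : ℝ) + kap * ((t₁ + 2 * (D + 1) + 2 : ℕ) : ℝ))) :=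
    ⟨_, rfl⟩
  have hg2 : gam ^ 2 ≤ 1 := by
    have h := abs_le.1 hgam
    nlinarith
  -- coefficient bounds
  have hc9 : |-8 * gam * lam| ≤ 8 := by
    have h := mul_le_mul hgam hlam (abs_nonneg lam) zero_le_one
    rw [abs_mul, abs_mul, abs_neg, abs_of_nonneg (by norm_num : (0 : ℝ) ≤ 8), mul_assoc]
    linarith
  have hc8 : |-4 * gam * kap| ≤ 4 := by
    have h := mul_le_mul hgam hkap (abs_nonneg kap) zero_le_one
    rw [abs_mul, abs_mul, abs_neg, abs_of_nonneg (by norm_num : (0 : ℝ) ≤ 4), mul_assoc]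
    linarith
  have hα : |4 * gam ^ 2| ≤ 4 := by
    rw [abs_of_nonneg (by positivity : (0 : ℝ) ≤ 4 * gam ^ 2)]; linarith
  have hG₂0 : 0 ≤ 16 * ((t₁ + 2 * (D + 1) + 2 : ℕ) : ℝ) * G := by positivity
  have hG₂ : ∀ x ∈ Icc (0 : ℤ) (((t₁ + 2 * (D + 1) + 2) : ℕ) : ℤ), |χ x| ≤ 16 * ((t₁ + 2 * (D + 1) + 2 : ℕ) : ℝ) * G := by
    intro x hx
    have hψ := hG x hx
    rw [mem_Icc] at hx
    have hx0 : (0 : ℝ) ≤ x := by exact_mod_cast hx.1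
    have hxt : (x : ℝ) ≤ ((t₁ + 2 * (D + 1) + 2 : ℕ) : ℝ) := by exact_mod_cast hx.2
    have hl := abs_le.1 hlam
    have hk := abs_le.1 hkap
    have hlin : |2 * lam * (x : ℝ) + kap * ((t₁ + 2 * (D + 1) + 2 : ℕ) : ℝ)| ≤ 3 * ((t₁ + 2 * (D + 1) + 2 : ℕ) : ℝ) := by
      rw [abs_le]; constructor <;> nlinarith
    have hA : |4 * gam ^ 2 * ψ x| ≤ 4 * G := by
      rw [abs_mul, abs_of_nonneg (by positivity : (0 : ℝ) ≤ 4 * gam ^ 2)]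
      calc 4 * gam ^ 2 * |ψ x| ≤ 4 * 1 * G := by gcongr
        _ = 4 * G := by ring
    have hB : |4 * gam * (ψ x * (2 * lam * (x : ℝ) + kap * ((t₁ + 2 * (D + 1) + 2 : ℕ) : ℝ)))| ≤ 4 * (G * (3 * ((t₁ + 2 * (D + 1) + 2 : ℕ) : ℝ))) := by
      rw [abs_mul, abs_mul, abs_mul, abs_of_nonneg (by norm_num : (0 : ℝ) ≤ 4)]
      calc 4 * |gam| * (|ψ x| * |2 * lam * (x : ℝ) + kap * ((t₁ + 2 * (D + 1) + 2 : ℕ) : ℝ)|) ≤ 4 * 1 * (G * (3 * ((t₁ + 2 * (D + 1) + 2 : ℕ) : ℝ))) := by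
            gcongr
        _ = 4 * (G * (3 * ((t₁ + 2 * (D + 1) + 2 : ℕ) : ℝ))) := by ring
    rw [hχ]
    calc |4 * gam ^ 2 * ψ x + 4 * gam * (ψ x * (2 * lam * (x : ℝ) + kap * ((t₁ + 2 * (D + 1) + 2 : ℕ) : ℝ)))|
        ≤ |4 * gam ^ 2 * ψ x| + |4 * gam * (ψ x * (2 * lam * (x : ℝ) + kap * ((t₁ + 2 * (D + 1) + 2 : ℕ) : ℝ)))| := abs_add_le _ _
      _ ≤ 4 * G + 4 * (G * (3 * ((t₁ + 2 * (D + 1) + 2 : ℕ) : ℝ))) := add_le_add hA hB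
      _ ≤ 16 * ((t₁ + 2 * (D + 1) + 2 : ℕ) : ℝ) * G := by
          have := mul_le_mul_of_nonneg_left ht1 hG0
          nlinarith
  -- Step 1: pointwise expansion on the support of the weight
  have hpt : ∀ U : OddSet n, levelWeight n (t₁ + 2 * (D + 1) + 2) C w U M *
      (ψ ((U.1 ∩ H).card : ℤ) *
        (∑ p : Fin n, (gam * (if (p ∈ H ∧ M.2.partner p ∈ H) then (1 : ℝ) else 0) +
              (lam * ((if (p ∈ H ∧ M.2.partner p ∈ H) then (1 : ℝ) else 0) -
                (if (p ∉ H ∧ M.2.partner p ∉ H) then (1 : ℝ) else 0)) + (lam + kap))) *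
          ((if p ∈ U.1 then (1 : ℝ) else 0) * (if M.2.partner p ∈ U.1 then (1 : ℝ) else 0))) ^ 2) =
      levelWeight n (t₁ + 2 * (D + 1) + 2) C w U M *
        (ψ ((U.1 ∩ H).card : ℤ) *
          (∑ p : Fin n, (lam * ((if (p ∈ H ∧ M.2.partner p ∈ H) then (1 : ℝ) else 0) -
              (if (p ∉ H ∧ M.2.partner p ∉ H) then (1 : ℝ) else 0)) + (lam + kap)) *
            ((if p ∈ U.1 then (1 : ℝ) else 0) * (if M.2.partner p ∈ U.1 then (1 : ℝ) else 0))) ^ 2) +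
      levelWeight n (t₁ + 2 * (D + 1) + 2) C w U M *
        (4 * gam ^ 2 * (ψ ((U.1 ∩ H).card : ℤ) *
          (((((reps M.2.partner (vAA M.2.partner univ H)).filter fun v => v ∈ U.1 ∧ M.2.partner v ∈ U.1).card : ℕ) : ℝ) *
            (((((reps M.2.partner (vAA M.2.partner univ H)).filter fun v => v ∈ U.1 ∧ M.2.partner v ∈ U.1).card : ℕ) : ℝ) - 1))) +
          χ ((U.1 ∩ H).card : ℤ) * ((((reps M.2.partner (vAA M.2.partner univ H)).filter fun v => v ∈ U.1 ∧ M.2.partner v ∈ U.1).card : ℕ) : ℝ)) +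
      (-8 * gam * lam) * (levelWeight n (t₁ + 2 * (D + 1) + 2) C w U M *
        (ψ ((U.1 ∩ H).card : ℤ) * ((((reps M.2.partner (vAA M.2.partner univ H)).filter fun v => v ∈ U.1 ∧ M.2.partner v ∈ U.1).card : ℕ) : ℝ) *
          ((half M.2.partner U.1 ∩ H).card : ℝ))) +
      (-4 * gam * kap) * (levelWeight n (t₁ + 2 * (D + 1) + 2) C w U M *
        ((cc U M : ℝ) ^ 1 * (ψ ((U.1 ∩ H).card : ℤ) * ((((reps M.2.partner (vAA M.2.partner univ H)).filter fun v => v ∈ U.1 ∧ M.2.partner v ∈ U.1).card : ℕ) : ℝ)))) := by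
    intro U
    by_cases hcard : U.1.card = (t₁ + 2 * (D + 1) + 2)
    · have hmem : U.1 ∈ shellIn M.2.partner univ (t₁ + 2 * (D + 1) + 2) (half M.2.partner U.1).card :=
        mem_shellIn.2 ⟨subset_univ _, hcard, rfl⟩
      rw [gammaWeight_containment_eq hπ hπ' H hmem gam lam (lam + kap),
        crossingWeight_containment_eq hπ H hmem lam (lam + kap), cc_eq_card_half, hχ]
      simp only
      push_cast
      ring
    · rw [levelWeight_eq_zero_of_card_ne (t₁ + 2 * (D + 1) + 2) C w U M hcard]
      ring
  -- Step 2: the main profile splits as `φ₀ + Φ₁`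
  have hΦ : (fun c : ℕ => (∑ U' ∈ shell M.2.partner (t₁ + 2 * (D + 1) + 2) c,
        ψ ((U' ∩ H).card : ℤ) *
          (2 * gam * ((((reps M.2.partner (vAA M.2.partner univ H)).filter fun v => v ∈ U' ∧ M.2.partner v ∈ U').card : ℕ) : ℝ) +
            2 * lam * ((U' ∩ H).card : ℤ) + kap * ((t₁ + 2 * (D + 1) + 2 : ℕ) : ℝ)) ^ 2) /
        ((shell M.2.partner (t₁ + 2 * (D + 1) + 2) c).card : ℝ)) =
      fun c : ℕ => (∑ U' ∈ shell M.2.partner (t₁ + 2 * (D + 1) + 2) c,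
          ψ ((U' ∩ H).card : ℤ) * (2 * lam * ((U' ∩ H).card : ℤ) + kap * ((t₁ + 2 * (D + 1) + 2 : ℕ) : ℝ)) ^ 2) /
          ((shell M.2.partner (t₁ + 2 * (D + 1) + 2) c).card : ℝ) +
        (∑ U' ∈ shell M.2.partner (t₁ + 2 * (D + 1) + 2) c,
          ((4 * gam ^ 2) * (ψ ((U' ∩ H).card : ℤ) *
            (((((reps M.2.partner (vAA M.2.partner univ H)).filter fun v => v ∈ U' ∧ M.2.partner v ∈ U').card : ℕ) : ℝ) *
              (((((reps M.2.partner (vAA M.2.partner univ H)).filter fun v => v ∈ U' ∧ M.2.partner v ∈ U').card : ℕ) : ℝ) - 1))) +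
           χ ((U' ∩ H).card : ℤ) *
            ((((reps M.2.partner (vAA M.2.partner univ H)).filter fun v => v ∈ U' ∧ M.2.partner v ∈ U').card : ℕ) : ℝ))) /
          ((shell M.2.partner (t₁ + 2 * (D + 1) + 2) c).card : ℝ) := by
    funext c
    rw [← add_div, ← sum_add_distrib]
    congr 1
    refine sum_congr rfl fun U' _ => ?_
    rw [hχ]
    simp only
    push_cast
    ring
  -- Step 3: the four pieces
  have hX120 : ∀ k, k ≤ D + 1 → ∀ e, e ≤ 2 → ∀ c' : ℕ, c' + 2 * k ≤ T → ∀ S' : Finset (Fin n),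
      (∀ u ∈ S', M.2.partner u ∈ S') → S'.card + 4 * k + 2 * e = n →
      ∑ x ∈ Icc (0 : ℤ) (((t₁ + 2 * (D + 1) + 2) - e : ℕ) : ℤ),
        |nab2^[k] (fun c x => shellLaw M.2.partner S' H ((t₁ + 2 * (D + 1) + 2) - e - 2 * k) c x : Profile) c' x| ≤ X k :=
    fun k hk e he c' hc' S' hS' hcard => hX k hk e e he le_rfl (by omega) c' hc' S' hS' hcard
  have hX1 : ∀ k, D ≤ k + 1 → k ≤ D + 1 → ∀ c' : ℕ, Odd c' → c' + 2 * k ≤ T →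
      ∀ S' : Finset (Fin n), (∀ u ∈ S', M.2.partner u ∈ S') → S'.card + 4 * k + 2 = n →
      ∑ x ∈ Icc (0 : ℤ) (((t₁ + 2 * (D + 1) + 2) - 2 : ℕ) : ℤ),
        |nab2^[k] (fun c x => shellLaw M.2.partner S' H ((t₁ + 2 * (D + 1) + 2) - 2 - 2 * k) c x : Profile) c' x| ≤ X k :=
    fun k _ hk c' _ hc' S' hS' hcard => hX k hk 1 2 (by norm_num) (by norm_num) (by norm_num) c' hc' S' hS' (by omega)
  have hX2 : ∀ k, D ≤ k + 1 → k ≤ D + 1 → ∀ c' : ℕ, Odd c' → c' + 2 * k ≤ T →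
      ∀ S' : Finset (Fin n), (∀ u ∈ S', M.2.partner u ∈ S') → S'.card + 4 * k + 4 = n →
      ∑ x ∈ Icc (0 : ℤ) (((t₁ + 2 * (D + 1) + 2) - 4 : ℕ) : ℤ),
        |nab2^[k] (fun c x => shellLaw M.2.partner S' H ((t₁ + 2 * (D + 1) + 2) - 4 - 2 * k) c x : Profile) c' x| ≤ X k :=
    fun k _ hk c' _ hc' S' hS' hcard => hX k hk 2 4 (by norm_num) (by norm_num) (by norm_num) c' hc' S' hS' (by omega)
  have hX9 : ∀ k, D ≤ k + 1 → k ≤ D + 1 → ∀ c' : ℕ, Even c' → c' + 2 * k + 1 ≤ T →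
      ∀ S' : Finset (Fin n), (∀ u ∈ S', M.2.partner u ∈ S') → S'.card + 4 * k + 4 = n →
      ∑ x ∈ Icc (0 : ℤ) (((t₁ + 2 * (D + 1) + 2) - 3 : ℕ) : ℤ),
        |nab2^[k] (fun c x => shellLaw M.2.partner S' H ((t₁ + 2 * (D + 1) + 2) - 3 - 2 * k) c x : Profile) c' x| ≤ X k :=
    fun k _ hk c' _ hc' S' hS' hcard => hX k hk 2 3 (by norm_num) (by norm_num) (by norm_num) c' (by omega) S' hS' (by omega)
  have h120 := abs_crossingPlane_value_add_newton_le hdes hDT M H ψ hG0 hG lam kap hlam hkap hm hmn X hX0 hX120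
  have h7 := abs_levelSum_hhMoments_add_newton_le hdes hT4 M H ψ χ hG0 hG hG₂0 hG₂ (4 * gam ^ 2) hm hmn X hX0 hX1 hX2
  have h8 := abs_designValue_level_hhCount_blockStat_le hdes hDT hT4 M H ψ hG0 hG hm hmn X hX0 hX1
  have h9 := abs_designValue_hhCount_halfCount_blockStat_le hdes hDT hT4 M H ψ hG0 hG hm hmn X hX0 hX9
  have hBt : 0 ≤ G * (((t₁ + 2 * (D + 1) + 2 : ℕ) : ℝ) * (((t₁ + 2 * (D + 1) + 2 : ℕ) : ℝ) * (((m : ℝ) / (4 * ((m : ℝ) - 2))) ^ (D + 1) * X (D + 1)) +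
        2 * ((D : ℝ) + 1) * (((m : ℝ) / (4 * ((m : ℝ) - 2))) ^ D * X D)) +
      2 * ((D : ℝ) + 1) * (((t₁ + 2 * (D + 1) + 2 : ℕ) : ℝ) * (((m : ℝ) / (4 * ((m : ℝ) - 2))) ^ D * X D) + 2 * (D : ℝ) * (((m : ℝ) / (4 * ((m : ℝ) - 2))) ^ (D - 1) * X (D - 1)))) := by
    have := hX0 (D + 1); have := hX0 D; have := hX0 (D - 1)
    positivity
  have hb7 : Bv * ((((T - 1) / 2).choose (D + 1) : ℕ) : ℝ) *
        (16 * ((t₁ + 2 * (D + 1) + 2 : ℕ) : ℝ) * G * (((t₁ + 2 * (D + 1) + 2 : ℕ) : ℝ) * (((m : ℝ) / (4 * ((m : ℝ) - 2))) ^ (D + 1) * X (D + 1)) + 2 * ((D : ℝ) + 1) * (((m : ℝ) / (4 * ((m : ℝ) - 2))) ^ D * X D)) +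
          |4 * gam ^ 2| * (G * (((t₁ + 2 * (D + 1) + 2 : ℕ) : ℝ) * (((t₁ + 2 * (D + 1) + 2 : ℕ) : ℝ) * (((m : ℝ) / (4 * ((m : ℝ) - 2))) ^ (D + 1) * X (D + 1)) +
              2 * ((D : ℝ) + 1) * (((m : ℝ) / (4 * ((m : ℝ) - 2))) ^ D * X D)) +
            2 * ((D : ℝ) + 1) * (((t₁ + 2 * (D + 1) + 2 : ℕ) : ℝ) * (((m : ℝ) / (4 * ((m : ℝ) - 2))) ^ D * X D) + 2 * (D : ℝ) * (((m : ℝ) / (4 * ((m : ℝ) - 2))) ^ (D - 1) * X (D - 1)))))) ≤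
      Bv * ((((T - 1) / 2).choose (D + 1) : ℕ) : ℝ) *
        (16 * ((t₁ + 2 * (D + 1) + 2 : ℕ) : ℝ) * G * (((t₁ + 2 * (D + 1) + 2 : ℕ) : ℝ) * (((m : ℝ) / (4 * ((m : ℝ) - 2))) ^ (D + 1) * X (D + 1)) + 2 * ((D : ℝ) + 1) * (((m : ℝ) / (4 * ((m : ℝ) - 2))) ^ D * X D)) +
          4 * (G * (((t₁ + 2 * (D + 1) + 2 : ℕ) : ℝ) * (((t₁ + 2 * (D + 1) + 2 : ℕ) : ℝ) * (((m : ℝ) / (4 * ((m : ℝ) - 2))) ^ (D + 1) * X (D + 1)) +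
              2 * ((D : ℝ) + 1) * (((m : ℝ) / (4 * ((m : ℝ) - 2))) ^ D * X D)) +
            2 * ((D : ℝ) + 1) * (((t₁ + 2 * (D + 1) + 2 : ℕ) : ℝ) * (((m : ℝ) / (4 * ((m : ℝ) - 2))) ^ D * X D) + 2 * (D : ℝ) * (((m : ℝ) / (4 * ((m : ℝ) - 2))) ^ (D - 1) * X (D - 1)))))) :=
    mul_le_mul_of_nonneg_left ((add_le_add_iff_left _).2 (mul_le_mul_of_nonneg_right hα hBt)) (mul_nonneg hBv (Nat.cast_nonneg _))
  -- Step 4: sum, split, combine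
  rw [sum_congr rfl fun U _ => hpt U]
  simp only [sum_add_distrib, ← mul_sum]
  rw [hΦ, newtonPolyOdd_eval_zero_add]
  refine abs_combine_le h120 ?_ h7 hb7 h9 h8 hc9 hc8
  rw [designValue_eq_shellAvg (t₁ + 2 * (D + 1) + 2) ht C w M (fun U₁ => (4 * gam ^ 2) * (ψ ((U₁ ∩ H).card : ℤ) *
      (((((reps M.2.partner (vAA M.2.partner univ H)).filter fun v => v ∈ U₁ ∧ M.2.partner v ∈ U₁).card : ℕ) : ℝ) *
        (((((reps M.2.partner (vAA M.2.partner univ H)).filter fun v => v ∈ U₁ ∧ M.2.partner v ∈ U₁).card : ℕ) : ℝ) - 1))) +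
      χ ((U₁ ∩ H).card : ℤ) * ((((reps M.2.partner (vAA M.2.partner univ H)).filter fun v => v ∈ U₁ ∧ M.2.partner v ∈ U₁).card : ℕ) : ℝ)),
    ← mul_assoc, mul_inv_cancel₀ hPM.ne', one_mul]

end Summit.PneNP.PneNP.Theorems.ChebyshevTracialDesignGammaDirectionReduction

end
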